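import Summits.CriticalPhenomena.Ising3DConformalLimit.Theorems.SubPtolemyInterlacingInterlacingBoxSwitching
import Summits.CriticalPhenomena.Ising3DConformalLimit.Theorems.EnergyNotSigmaSquaredGapForcesFarMergingScreeningIdentity
import HarnessLib

/-!
# Line `birth` (BC3 birth skeleton) for the crux `SubPtolemyInterlacing.Interlacing` (stmt-CriticalPhenomena-15702) —
# stub `stub_defectIdentity`: the box SPC defect is the screening excess

In the free box `Λ_n ∋ x₁,…,x₄` (`x₁ = 0, x₂ = a e₁, x₃ = (a+b) e₁, x₄ = (a+b+c) e₁`, `a+b+c ≤ n`) at `β_c(3)`: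
`S₄ⁿ·P₂ⁿ − P₁ⁿ·P₃ⁿ = 2(P₂ⁿ)²·MSⁿ − (P₁ⁿ − P₂ⁿ)(P₃ⁿ − P₂ⁿ)` with `MSⁿ = meanScreening n n x₁ x₃ x₂ x₄`.
Proof: the landed box switching identity `Sketch.stub_boxSwitching` (ADC21 (3.11), line `Sketch` of the lead) and the
landed screening dictionary `stub_screeningIdentity` (ADC21 Lemma A.1, line `screening-form-lemma-a1` of the sibling crux
`GapForcesFarMerging`), then `ring`. Proves the registered stub verbatim (name + signature). No definitions, no sorry.
-/

noncomputable section

namespace Summit.CriticalPhenomena.Ising3DConformalLimit.Cruxes.Interlacing.Birth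

open Filter MeasureTheory
open scoped symmDiff Topology
open Literature.Probability.LatticeModels Literature.Probability.Percolation
open Summit.CriticalPhenomena.Ising3DConformalLimit.GapForcesFarMergingScreening (meanScreening)
open Summit.CriticalPhenomena.Ising3DConformalLimit.Cruxes.Interlacing.Sketch (stub_boxSwitching)
open Summit.CriticalPhenomena.Ising3DConformalLimit.EnergyNotSigmaSquaredGapForcesFarMerging (stub_screeningIdentity)

/-- Axis points `Pi.single 0 k` with `k ≤ n` lie in the box `Λ_n`. -/
private theorem single_mem_box {n k : ℕ} (hk : k ≤ n) : (Pi.single 0 ((k : ℕ) : ℤ) : Site 3) ∈ box 3 n := by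
  rw [mem_box]
  intro i
  by_cases hi : i = 0
  · subst hi
    simp only [Pi.single_eq_same]
    omega
  · simp [hi]

/-- **Stub `stub_defectIdentity`** (line `birth`, crux stmt-CriticalPhenomena-15702): the box SPC defect equals the
screening excess, `S₄ⁿP₂ⁿ − P₁ⁿP₃ⁿ = 2(P₂ⁿ)²·MSⁿ − (P₁ⁿ−P₂ⁿ)(P₃ⁿ−P₂ⁿ)` — `Sketch.stub_boxSwitching` + `stub_screeningIdentity`
+ `ring`. -/
theorem stub_defectIdentity : ∀ n a b c : ℕ, a + b + c ≤ n →
    isingExpect (zdGraph 3) (box 3 n) (criticalBeta 3) 0 .free (spinMonomial ![(Pi.single 0 ((0 : ℕ) : ℤ)), (Pi.single 0 ((a : ℕ) : ℤ)), (Pi.single 0 ((a + b : ℕ) : ℤ)), (Pi.single 0 ((a + b + c : ℕ) : ℤ))]) *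
          (isingTwoPoint (zdGraph 3) (box 3 n) (criticalBeta 3) 0 .free (Pi.single 0 ((0 : ℕ) : ℤ)) (Pi.single 0 ((a + b : ℕ) : ℤ)) *
            isingTwoPoint (zdGraph 3) (box 3 n) (criticalBeta 3) 0 .free (Pi.single 0 ((a : ℕ) : ℤ)) (Pi.single 0 ((a + b + c : ℕ) : ℤ))) -
        isingTwoPoint (zdGraph 3) (box 3 n) (criticalBeta 3) 0 .free (Pi.single 0 ((0 : ℕ) : ℤ)) (Pi.single 0 ((a : ℕ) : ℤ)) *
            isingTwoPoint (zdGraph 3) (box 3 n) (criticalBeta 3) 0 .free (Pi.single 0 ((a + b : ℕ) : ℤ)) (Pi.single 0 ((a + b + c : ℕ) : ℤ)) *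
          (isingTwoPoint (zdGraph 3) (box 3 n) (criticalBeta 3) 0 .free (Pi.single 0 ((0 : ℕ) : ℤ)) (Pi.single 0 ((a + b + c : ℕ) : ℤ)) *
            isingTwoPoint (zdGraph 3) (box 3 n) (criticalBeta 3) 0 .free (Pi.single 0 ((a : ℕ) : ℤ)) (Pi.single 0 ((a + b : ℕ) : ℤ))) =
      2 * (isingTwoPoint (zdGraph 3) (box 3 n) (criticalBeta 3) 0 .free (Pi.single 0 ((0 : ℕ) : ℤ)) (Pi.single 0 ((a + b : ℕ) : ℤ)) *
            isingTwoPoint (zdGraph 3) (box 3 n) (criticalBeta 3) 0 .free (Pi.single 0 ((a : ℕ) : ℤ)) (Pi.single 0 ((a + b + c : ℕ) : ℤ))) ^ 2 *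
          meanScreening n n (Pi.single 0 ((0 : ℕ) : ℤ)) (Pi.single 0 ((a + b : ℕ) : ℤ)) (Pi.single 0 ((a : ℕ) : ℤ)) (Pi.single 0 ((a + b + c : ℕ) : ℤ)) -
        (isingTwoPoint (zdGraph 3) (box 3 n) (criticalBeta 3) 0 .free (Pi.single 0 ((0 : ℕ) : ℤ)) (Pi.single 0 ((a : ℕ) : ℤ)) *
            isingTwoPoint (zdGraph 3) (box 3 n) (criticalBeta 3) 0 .free (Pi.single 0 ((a + b : ℕ) : ℤ)) (Pi.single 0 ((a + b + c : ℕ) : ℤ)) -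
          isingTwoPoint (zdGraph 3) (box 3 n) (criticalBeta 3) 0 .free (Pi.single 0 ((0 : ℕ) : ℤ)) (Pi.single 0 ((a + b : ℕ) : ℤ)) *
            isingTwoPoint (zdGraph 3) (box 3 n) (criticalBeta 3) 0 .free (Pi.single 0 ((a : ℕ) : ℤ)) (Pi.single 0 ((a + b + c : ℕ) : ℤ))) *
          (isingTwoPoint (zdGraph 3) (box 3 n) (criticalBeta 3) 0 .free (Pi.single 0 ((0 : ℕ) : ℤ)) (Pi.single 0 ((a + b + c : ℕ) : ℤ)) *
            isingTwoPoint (zdGraph 3) (box 3 n) (criticalBeta 3) 0 .free (Pi.single 0 ((a : ℕ) : ℤ)) (Pi.single 0 ((a + b : ℕ) : ℤ)) -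
            isingTwoPoint (zdGraph 3) (box 3 n) (criticalBeta 3) 0 .free (Pi.single 0 ((0 : ℕ) : ℤ)) (Pi.single 0 ((a + b : ℕ) : ℤ)) *
            isingTwoPoint (zdGraph 3) (box 3 n) (criticalBeta 3) 0 .free (Pi.single 0 ((a : ℕ) : ℤ)) (Pi.single 0 ((a + b + c : ℕ) : ℤ))) := by
  intro n a b c h
  have hsw := stub_boxSwitching n a b c h
  have hsc := stub_screeningIdentity n (Pi.single 0 ((0 : ℕ) : ℤ)) (Pi.single 0 ((a + b : ℕ) : ℤ))
    (Pi.single 0 ((a : ℕ) : ℤ)) (Pi.single 0 ((a + b + c : ℕ) : ℤ))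
    (single_mem_box (Nat.zero_le n)) (single_mem_box (by omega)) (single_mem_box (by omega)) (single_mem_box h)
  rw [hsc, hsw]
  ring

end Summit.CriticalPhenomena.Ising3DConformalLimit.Cruxes.Interlacing.Birth

end
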